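import Summits.HubbardSuperconductivity.HubbardSuperconductivity.Theorems.FunctionFieldCertificateWindowInfraredBoundBloch
import Summits.HubbardSuperconductivity.HubbardSuperconductivity.Theorems.NoGoNogoSingletPairKillsSaturatedFM
import Literature.MathematicalPhysics.QuantumLattice.HyperoctahedralFockAction
import Literature.MathematicalPhysics.QuantumLattice.FreeFermiGasNoPairFieldLRO
import HarnessLib

/-!
# Crux `WindowInfraredBound` (stmt-HubbardSuperconductivity-1089): spin × Bloch reduction

Support file (routes `FunctionFieldCertificate` / `KacWindowPenalty` / `GibbsMajorant`; line
lead c11), completing the symmetry bookkeeping of `…WindowInfraredBoundBloch` (translations) by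
the `SU(2)` Casimir (STRATEGY-CENSUS v2, N-s1.1 / S-s1.3: inside a degenerate sector ground
multiplet only vectors of the same crystal momentum AND total spin superpose coherently under the
window operator, the `d`-wave pair field being a spin singlet). §1: three pairwise commuting
symmetries of a Hermitian `A` preserving `K` admit a JOINT eigenvector minimising the Rayleigh
quotient of `A` on the unit sphere of `K` (`exists_unit_common_eigenvector₃_isMinOn`). §2:
`spinSq` commutes with `hubbardTorus 2 L t U`, with the translations, with every `Δ_g(m)` and
every real-weighted mode sum `A_w = Σ_m w_m • Δ_g(m)ᴴ Δ_g(m)`, and preserves `szSector N M`. §3: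
`forall_ground_modeSum_le_of_spinBloch` — an upper bound `Σ_m w_m ‖Δ_g(m) ψ‖² ≤ b` valid on
every normalised sector ground state that is an eigenvector of every `fockTranslate v` AND of
`spinSq` is valid on every normalised sector ground state. §4: `windowInfraredBound_iff_spinBloch`
(+ the `KacWindowPenalty` copy) — **the crux is equivalent to its restriction to Bloch ground
states of definite total spin**, same `(C, ε₀, L₀)`.

H. Tasaki, *Physics and Mathematics of Quantum Many-Body Systems* (2020) §2.1, §2.4, §4.1;
E. H. Lieb, PRL 62 (1989) 1201 (spin of Hubbard ground states). No definition is introduced.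
-/


noncomputable section

-- the summit namespace `Summit.HubbardSuperconductivity.HubbardSuperconductivity.…` repeats the problem name by design (D-0017)
set_option linter.dupNamespace false

namespace Summit.HubbardSuperconductivity.HubbardSuperconductivity.Theorems.WindowInfraredBound

open Matrix Finset
open Literature.Probability.LatticeModels Literature.MathematicalPhysics.QuantumLattice
open Summit.HubbardSuperconductivity.HubbardSuperconductivity.Theses
open Summit.HubbardSuperconductivity.HubbardSuperconductivity.Theorems.FunctionFieldCertificate
  (exists_isMinOn_re_rayleigh dotProduct_mulVec_eq_of_isMinOn exists_eigenvector_mem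
    exists_common_eigenvector_mem dotProduct_mulVec_eq_star_conjTranspose_mulVec_dotProduct
    fockTranslate_add_val conjTranspose_fockTranslate_val
    fockTranslate_mulVec_mem_ground forall_fockTranslate_mulVec_eq_smul_of_generators)
open scoped ComplexOrder ComplexConjugate

/-! ### §1 Joint eigenvectors of three commuting symmetries among Rayleigh minimisers -/

section Abstract

variable {n : Type*} [Fintype n] [DecidableEq n]

/-- **Three pairwise commuting matrices have a common eigenvector in every nonzero jointly
invariant subspace** (refine the joint `T₁, T₂`-eigenvector's joint eigenspace inside `W`, which
is `T₃`-invariant, and take an eigenvector of `T₃` there). [folklore] -/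
theorem exists_common_eigenvector₃_mem (T₁ T₂ T₃ : Matrix n n ℂ) (h12 : Commute T₁ T₂)
    (h13 : Commute T₁ T₃) (h23 : Commute T₂ T₃) (W : Submodule ℂ (n → ℂ)) (hW : W ≠ ⊥)
    (h1 : ∀ w ∈ W, T₁ *ᵥ w ∈ W) (h2 : ∀ w ∈ W, T₂ *ᵥ w ∈ W) (h3 : ∀ w ∈ W, T₃ *ᵥ w ∈ W) :
    ∃ w ∈ W, w ≠ 0 ∧ (∃ c₁ : ℂ, T₁ *ᵥ w = c₁ • w) ∧ (∃ c₂ : ℂ, T₂ *ᵥ w = c₂ • w) ∧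
      (∃ c₃ : ℂ, T₃ *ᵥ w = c₃ • w) := by
  obtain ⟨w₀, hw₀W, hw₀0, ⟨c₁, hw₀1⟩, ⟨c₂, hw₀2⟩⟩ := exists_common_eigenvector_mem T₁ T₂ h12 W hW h1 h2
  -- the joint `(c₁, c₂)`-eigenspace inside `W`
  set W₂ : Submodule ℂ (n → ℂ) := W ⊓ Module.End.eigenspace (Matrix.toLin' T₁) c₁ ⊓
    Module.End.eigenspace (Matrix.toLin' T₂) c₂ with hW₂
  have hmem : ∀ w : n → ℂ, w ∈ W₂ ↔ w ∈ W ∧ T₁ *ᵥ w = c₁ • w ∧ T₂ *ᵥ w = c₂ • w := fun w => by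
    rw [hW₂, Submodule.mem_inf, Submodule.mem_inf, Module.End.mem_eigenspace_iff,
      Module.End.mem_eigenspace_iff, Matrix.toLin'_apply, Matrix.toLin'_apply, and_assoc]
  have hW₂ne : W₂ ≠ ⊥ := by
    rw [Submodule.ne_bot_iff]
    exact ⟨w₀, (hmem w₀).2 ⟨hw₀W, hw₀1, hw₀2⟩, hw₀0⟩
  have h3' : ∀ w ∈ W₂, T₃ *ᵥ w ∈ W₂ := by
    intro w hw
    obtain ⟨hwW, hw1, hw2⟩ := (hmem w).1 hw
    refine (hmem _).2 ⟨h3 w hwW, ?_, ?_⟩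
    · rw [mulVec_mulVec, h13.eq, ← mulVec_mulVec, hw1, mulVec_smul]
    · rw [mulVec_mulVec, h23.eq, ← mulVec_mulVec, hw2, mulVec_smul]
  obtain ⟨w, hwW₂, hw0, c₃, hw₃⟩ := exists_eigenvector_mem T₃ W₂ hW₂ne h3'
  obtain ⟨hwW, hw1, hw2⟩ := (hmem w).1 hwW₂
  exact ⟨w, hwW, hw0, ⟨c₁, hw1⟩, ⟨c₂, hw2⟩, ⟨c₃, hw₃⟩⟩

/-- **Symmetry-adapted Rayleigh minimisers, three symmetries.** Let `A` be Hermitian, `K` a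
subspace containing a unit vector, and `T₁, T₂, T₃` pairwise commuting matrices that commute with
`A` and preserve `K` together with their adjoints. Then the minimum of `Re⟨φ, A φ⟩` over the unit
vectors of `K` is attained at a common eigenvector of `T₁, T₂, T₃` (the weak eigenspace of the
minimum is invariant under all three; `exists_common_eigenvector₃_mem`). Tasaki (2020) §2.1, §2.4,
§4.1. [folklore] -/
theorem exists_unit_common_eigenvector₃_isMinOn {A T₁ T₂ T₃ : Matrix n n ℂ} (hA : A.IsHermitian)
    (K : Submodule ℂ (n → ℂ)) (hK : ∃ ψ ∈ K, star ψ ⬝ᵥ ψ = 1) (h12 : Commute T₁ T₂)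
    (h13 : Commute T₁ T₃) (h23 : Commute T₂ T₃)
    (hA1 : Commute T₁ A) (hA2 : Commute T₂ A) (hA3 : Commute T₃ A)
    (hK1 : ∀ v ∈ K, T₁ *ᵥ v ∈ K) (hK1' : ∀ v ∈ K, T₁ᴴ *ᵥ v ∈ K)
    (hK2 : ∀ v ∈ K, T₂ *ᵥ v ∈ K) (hK2' : ∀ v ∈ K, T₂ᴴ *ᵥ v ∈ K)
    (hK3 : ∀ v ∈ K, T₃ *ᵥ v ∈ K) (hK3' : ∀ v ∈ K, T₃ᴴ *ᵥ v ∈ K) :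
    ∃ φ ∈ K, star φ ⬝ᵥ φ = 1 ∧ (∃ c₁ : ℂ, T₁ *ᵥ φ = c₁ • φ) ∧ (∃ c₂ : ℂ, T₂ *ᵥ φ = c₂ • φ) ∧
      (∃ c₃ : ℂ, T₃ *ᵥ φ = c₃ • φ) ∧
      ∀ ψ ∈ K, star ψ ⬝ᵥ ψ = 1 → (star φ ⬝ᵥ A *ᵥ φ).re ≤ (star ψ ⬝ᵥ A *ᵥ ψ).re := by
  obtain ⟨φ₀, h0K, h01, hmin⟩ := exists_isMinOn_re_rayleigh A K hK
  set μ : ℝ := (star φ₀ ⬝ᵥ A *ᵥ φ₀).re with hμ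
  -- the weak eigenspace of the minimum
  set W : Submodule ℂ (n → ℂ) :=
    { carrier := {φ | φ ∈ K ∧ ∀ ψ ∈ K, star ψ ⬝ᵥ A *ᵥ φ = ((μ : ℝ) : ℂ) * (star ψ ⬝ᵥ φ)}
      add_mem' := by
        rintro a b ⟨haK, ha⟩ ⟨hbK, hb⟩
        refine ⟨K.add_mem haK hbK, fun ψ hψ => ?_⟩
        rw [mulVec_add, dotProduct_add, dotProduct_add, ha ψ hψ, hb ψ hψ, mul_add]
      zero_mem' := ⟨K.zero_mem, fun ψ _ => by simp⟩
      smul_mem' := by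
        rintro c a ⟨haK, ha⟩
        refine ⟨K.smul_mem c haK, fun ψ hψ => ?_⟩
        rw [mulVec_smul, dotProduct_smul, dotProduct_smul, ha ψ hψ, smul_eq_mul, smul_eq_mul]
        ring } with hW
  have hmemW : ∀ φ : n → ℂ, φ ∈ W ↔
      φ ∈ K ∧ ∀ ψ ∈ K, star ψ ⬝ᵥ A *ᵥ φ = ((μ : ℝ) : ℂ) * (star ψ ⬝ᵥ φ) := fun φ => Iff.rfl
  have hφ₀W : φ₀ ∈ W :=
    (hmemW φ₀).2 ⟨h0K, fun ψ hψ => dotProduct_mulVec_eq_of_isMinOn hA K h01 hmin h0K hψ⟩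
  have hφ₀0 : φ₀ ≠ 0 := by
    intro h
    rw [h, star_zero, zero_dotProduct] at h01
    exact zero_ne_one h01
  have hWne : W ≠ ⊥ := by
    rw [Submodule.ne_bot_iff]
    exact ⟨φ₀, hφ₀W, hφ₀0⟩
  -- invariance of `W` under a matrix commuting with `A` and preserving `K` with its adjoint
  have hinv : ∀ T : Matrix n n ℂ, Commute T A → (∀ v ∈ K, T *ᵥ v ∈ K) →
      (∀ v ∈ K, Tᴴ *ᵥ v ∈ K) → ∀ φ ∈ W, T *ᵥ φ ∈ W := by
    intro T hTA hTK hTK' φ hφ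
    obtain ⟨hφK, hφw⟩ := (hmemW φ).1 hφ
    refine (hmemW _).2 ⟨hTK φ hφK, fun ψ hψ => ?_⟩
    rw [mulVec_mulVec, ← hTA.eq, ← mulVec_mulVec,
      dotProduct_mulVec_eq_star_conjTranspose_mulVec_dotProduct T ψ (A *ᵥ φ),
      hφw _ (hTK' ψ hψ), ← dotProduct_mulVec_eq_star_conjTranspose_mulVec_dotProduct]
  obtain ⟨w, hwW, hw0, ⟨c₁, hw1⟩, ⟨c₂, hw2⟩, ⟨c₃, hw3⟩⟩ :=
    exists_common_eigenvector₃_mem T₁ T₂ T₃ h12 h13 h23 W hWne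
      (hinv T₁ hA1 hK1 hK1') (hinv T₂ hA2 hK2 hK2') (hinv T₃ hA3 hK3 hK3')
  -- normalise
  obtain ⟨c, hc0, hc1⟩ := exists_smul_unit hw0
  have hcwW : c • w ∈ W := W.smul_mem c hwW
  obtain ⟨hcwK, hcw⟩ := (hmemW _).1 hcwW
  refine ⟨c • w, hcwK, hc1, ⟨c₁, by rw [mulVec_smul, hw1, smul_comm]⟩,
    ⟨c₂, by rw [mulVec_smul, hw2, smul_comm]⟩, ⟨c₃, by rw [mulVec_smul, hw3, smul_comm]⟩,
    fun ψ hψK hψ => ?_⟩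
  -- every unit vector of `W` attains `μ`
  have hval : (star (c • w) ⬝ᵥ A *ᵥ (c • w)).re = μ := by
    rw [hcw _ hcwK, hc1, mul_one, Complex.ofReal_re]
  rw [hval]
  exact hmin ψ hψK hψ

end Abstract

/-! ### §2 The total-spin Casimir is a symmetry of `H_L`, of the sectors, of the translations
and of the pair mode sums -/

section Spin

variable {L : ℕ} [NeZero L]

omit [NeZero L] in
/-- **`[S², H_L] = 0`**: the Casimir `spinSq = (S^z)² + ½(S⁺S⁻ + S⁻S⁺)` commutes with the
Hubbard Hamiltonian on the torus (`H` commutes with `S⁺`, with `S⁻ = (S⁺)ᴴ`, and — conserving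
`N↑, N↓` — with the diagonal `S^z`). Lieb, PRL 62 (1989) 1201; Tasaki (2020) §9.3.2. [folklore] -/
theorem spinSq_commute_hubbardTorus (t U : ℝ) :
    Commute (spinSq : Matrix (Finset (Orb (FermionTorus 2 L))) _ ℂ) (hubbardTorus 2 L t U) := by
  have hP : Commute (hubbardTorus 2 L t U) (spinPlus : Matrix (Finset (Orb (FermionTorus 2 L))) _ ℂ) :=
    LiebThm1.hamiltonian_commute_spinPlus (fermionTorusGraph 2 L) t U
  have hM : Commute (hubbardTorus 2 L t U) (spinPlusᴴ : Matrix (Finset (Orb (FermionTorus 2 L))) _ ℂ) :=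
    LiebThm1.hamiltonian_commute_spinMinus (fermionTorusGraph 2 L) t U
  have hZ : Commute (hubbardTorus 2 L t U) (HubbardWave0.spinZ : Matrix (Finset (Orb (FermionTorus 2 L))) _ ℂ) := by
    rw [LiebThm1.spinZ_eq_diagonal]
    exact (LiebThm1.preservesSectors_hamiltonian (fermionTorusGraph 2 L) t U).commute_diagonal
      fun a b => (1 / 2 : ℂ) * ((a : ℂ) - (b : ℂ))
  rw [spinSq]
  exact ((hZ.mul_right hZ).add_right
    (((hP.mul_right hM).add_right (hM.mul_right hP)).smul_right _)).symm

omit [NeZero L] in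
/-- `S²` maps every joint sector `szSector N M` into itself (it conserves `N↑` and `N↓`). Lieb,
PRL 62 (1989) 1201, eq. (2). [folklore] -/
theorem spinSq_mulVec_mem_szSector {N : ℕ} {M : ℝ} {v : Fock (Orb (FermionTorus 2 L))}
    (hv : v ∈ szSector N M) :
    (spinSq : Matrix (Finset (Orb (FermionTorus 2 L))) _ ℂ) *ᵥ v ∈ szSector N M := by
  have hA := Summit.HubbardSuperconductivity.NoGo.preservesSectors_spinSq (Λ := FermionTorus 2 L)
  have hN : Commute (spinSq : Matrix (Finset (Orb (FermionTorus 2 L))) _ ℂ) totalNumber := by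
    rw [LiebThm1.totalNumber_eq_diagonal]
    exact hA.commute_diagonal fun a b => ((a + b : ℕ) : ℂ)
  have hS : Commute (spinSq : Matrix (Finset (Orb (FermionTorus 2 L))) _ ℂ) HubbardWave0.spinZ := by
    rw [LiebThm1.spinZ_eq_diagonal]
    exact hA.commute_diagonal fun a b => (1 / 2 : ℂ) * ((a : ℂ) - (b : ℂ))
  exact mulVec_mem_szSector_of_commute hN hS hv

/-- **`[S², T_v] = 0`**: the Casimir is invariant under every site bijection, in particular under
the lattice translations. [folklore] -/
theorem spinSq_commute_fockTranslate (v : TorusSite 2 L) :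
    Commute (spinSq : Matrix (Finset (Orb (FermionTorus 2 L))) _ ℂ) (fockTranslate v).val :=
  (fockRelabel_commute_of_relabel_eq _ (relabel_mapEquiv_spinSq _)).symm

/-- **`[S², Δ_g(m)] = 0`**: the momentum-resolved pair field of SINGLET pairs is a spin scalar.
Tasaki (1998) p. 20; Scalapino, Phys. Rep. 250 (1995) 329, §2. [folklore] -/
theorem spinSq_commute_pairFieldAt (g : Site 2 → ℝ) (m : TorusSite 2 L) :
    Commute (spinSq : Matrix (Finset (Orb (FermionTorus 2 L))) _ ℂ) (pairFieldAt g L m) := by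
  rw [pairFieldAt_def]
  exact Commute.sum_right _ _ _ fun x _ =>
    (Summit.HubbardSuperconductivity.NoGo.spinSq_commute_localPair g L x).smul_right _

/-- `[S², Δ_g(m)ᴴ Δ_g(m)] = 0` (`S²` is Hermitian). [folklore] -/
theorem spinSq_commute_pairFieldAt_conjTranspose_mul (g : Site 2 → ℝ) (m : TorusSite 2 L) :
    Commute (spinSq : Matrix (Finset (Orb (FermionTorus 2 L))) _ ℂ)
      ((pairFieldAt g L m)ᴴ * pairFieldAt g L m) := by
  have h := spinSq_commute_pairFieldAt (L := L) g m
  have h' : Commute (spinSq : Matrix (Finset (Orb (FermionTorus 2 L))) _ ℂ) (pairFieldAt g L m)ᴴ := by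
    have h2 : Commute (spinSq : Matrix (Finset (Orb (FermionTorus 2 L))) _ ℂ)ᴴ (pairFieldAt g L m)ᴴ :=
      commute_star_star.2 h
    rwa [LiebTwo.spinSq_conjTranspose] at h2
  exact h'.mul_right h

/-- `[S², A_w] = 0` for every real-weighted mode sum `A_w = Σ_m w_m • Δ_g(m)ᴴ Δ_g(m)`. [folklore] -/
theorem spinSq_commute_modeSum (g : Site 2 → ℝ) (w : TorusSite 2 L → ℝ) :
    Commute (spinSq : Matrix (Finset (Orb (FermionTorus 2 L))) _ ℂ)
      (∑ m : TorusSite 2 L, ((w m : ℝ) : ℂ) • ((pairFieldAt g L m)ᴴ * pairFieldAt g L m)) :=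
  Commute.sum_right _ _ _ fun m _ => (spinSq_commute_pairFieldAt_conjTranspose_mul g m).smul_right _

end Spin

/-! ### §3 Weighted mode sums over the ground multiplet are maximised at Bloch ground states of
definite total spin -/

section SpinBloch

variable {L : ℕ} [NeZero L]

/-- **Spin × Bloch reduction of an every-ground-state UPPER bound, at fixed data.** If on the
torus of side `L` every normalised `(N, S^z = M)`-sector ground state of `hubbardTorus 2 L t U`
that is an eigenvector of EVERY lattice translation `T_v` AND of the total-spin Casimir `S²` has
`Σ_m w_m ‖Δ_g(m) ψ‖² ≤ b` (real weights `w`, any form factor `g`), then so does every normalised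
sector ground state. Proof: the sector ground eigenspace `G` is invariant under the translations,
under `S²` and their adjoints; `A_w` is Hermitian and commutes with all of them, and they commute
pairwise; so (`exists_unit_common_eigenvector₃_isMinOn` for `-A_w`) the MAXIMUM of `Re⟨φ, A_w φ⟩`
on the unit sphere of `G` is attained at a joint eigenvector of `T_{e₁}, T_{e₂}, S²`. [folklore] -/
theorem forall_ground_modeSum_le_of_spinBloch (L : ℕ) [NeZero L] (g : Site 2 → ℝ) (t U : ℝ)
    (N : ℕ) (M : ℝ) (w : TorusSite 2 L → ℝ) (b : ℝ)
    (h : ∀ ψ : Fock (Orb (FermionTorus 2 L)), star ψ ⬝ᵥ ψ = 1 →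
      IsGroundStateInSector (hubbardTorus 2 L t U) N M ψ →
        (∀ v : TorusSite 2 L, ∃ c : ℂ, (fockTranslate v).val *ᵥ ψ = c • ψ) →
          (∃ s : ℂ, (spinSq : Matrix (Finset (Orb (FermionTorus 2 L))) _ ℂ) *ᵥ ψ = s • ψ) →
            ∑ m : TorusSite 2 L,
              w m * (star (pairFieldAt g L m *ᵥ ψ) ⬝ᵥ (pairFieldAt g L m *ᵥ ψ)).re ≤ b)
    (ψ : Fock (Orb (FermionTorus 2 L))) (hψ : star ψ ⬝ᵥ ψ = 1)
    (hgs : IsGroundStateInSector (hubbardTorus 2 L t U) N M ψ) :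
    ∑ m : TorusSite 2 L, w m * (star (pairFieldAt g L m *ᵥ ψ) ⬝ᵥ (pairFieldAt g L m *ᵥ ψ)).re ≤ b := by
  set H := hubbardTorus 2 L t U with hH
  set E : ℂ := ((H.minEnergyOn (szSector (Λ := FermionTorus 2 L) N M) : ℝ) : ℂ) with hEdef
  -- the sector ground eigenspace
  set G : Submodule ℂ (Fock (Orb (FermionTorus 2 L))) :=
    szSector (Λ := FermionTorus 2 L) N M ⊓ Module.End.eigenspace (Matrix.toLin' H) E with hG
  have hmemG : ∀ φ : Fock (Orb (FermionTorus 2 L)),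
      φ ∈ G ↔ φ ∈ szSector (Λ := FermionTorus 2 L) N M ∧ H *ᵥ φ = E • φ := fun φ => by
    rw [hG, Submodule.mem_inf, Module.End.mem_eigenspace_iff, Matrix.toLin'_apply]
  have hψG : ψ ∈ G := (hmemG ψ).2 ⟨hgs.1, hgs.2.2⟩
  -- the weighted mode sum and its negative
  set A : Matrix (Finset (Orb (FermionTorus 2 L))) (Finset (Orb (FermionTorus 2 L))) ℂ :=
    ∑ m : TorusSite 2 L, ((w m : ℝ) : ℂ) • ((pairFieldAt g L m)ᴴ * pairFieldAt g L m) with hA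
  have hAH : (-A).IsHermitian := (isHermitian_modeSum g w).neg
  set T₁ := (fockTranslate (Pi.single 0 1 : TorusSite 2 L)).val with hT₁
  set T₂ := (fockTranslate (Pi.single 1 1 : TorusSite 2 L)).val with hT₂
  set T₃ := (spinSq : Matrix (Finset (Orb (FermionTorus 2 L))) _ ℂ) with hT₃
  have h12 : Commute T₁ T₂ := by
    change (fockTranslate (Pi.single 0 1 : TorusSite 2 L)).val *
        (fockTranslate (Pi.single 1 1 : TorusSite 2 L)).val =
      (fockTranslate (Pi.single 1 1 : TorusSite 2 L)).val *
        (fockTranslate (Pi.single 0 1 : TorusSite 2 L)).val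
    rw [← fockTranslate_add_val, ← fockTranslate_add_val, add_comm]
  have h13 : Commute T₁ T₃ := (spinSq_commute_fockTranslate _).symm
  have h23 : Commute T₂ T₃ := (spinSq_commute_fockTranslate _).symm
  have hGinv : ∀ v : TorusSite 2 L, ∀ φ ∈ G, (fockTranslate v).val *ᵥ φ ∈ G := by
    intro v φ hφ
    obtain ⟨hφS, hφE⟩ := (hmemG φ).1 hφ
    exact (hmemG _).2 (fockTranslate_mulVec_mem_ground t U N M E v hφS hφE)
  have hGinv' : ∀ v : TorusSite 2 L, ∀ φ ∈ G, ((fockTranslate v).val)ᴴ *ᵥ φ ∈ G := by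
    intro v φ hφ
    rw [conjTranspose_fockTranslate_val]
    exact hGinv (-v) φ hφ
  have hG3 : ∀ φ ∈ G, T₃ *ᵥ φ ∈ G := by
    intro φ hφ
    obtain ⟨hφS, hφE⟩ := (hmemG φ).1 hφ
    refine (hmemG _).2 ⟨spinSq_mulVec_mem_szSector hφS, ?_⟩
    rw [hT₃, mulVec_mulVec, ← (spinSq_commute_hubbardTorus t U).eq, ← mulVec_mulVec, hφE, mulVec_smul]
  have hG3' : ∀ φ ∈ G, T₃ᴴ *ᵥ φ ∈ G := by
    intro φ hφ
    rw [hT₃, LiebTwo.spinSq_conjTranspose]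
    exact hG3 φ hφ
  obtain ⟨φ, hφG, hφ1, hc₁, hc₂, hc₃, hmin⟩ := exists_unit_common_eigenvector₃_isMinOn hAH G
    ⟨ψ, hψG, hψ⟩ h12 h13 h23 (fockTranslate_commute_modeSum g w _).neg_right
    (fockTranslate_commute_modeSum g w _).neg_right (spinSq_commute_modeSum g w).neg_right
    (hGinv _) (hGinv' _) (hGinv _) (hGinv' _) hG3 hG3'
  -- `φ` is a Bloch ground state of definite total spin
  have hbloch := forall_fockTranslate_mulVec_eq_smul_of_generators hc₁ hc₂
  obtain ⟨hφS, hφE⟩ := (hmemG φ).1 hφG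
  have hφ0 : φ ≠ 0 := by
    intro h0
    rw [h0, star_zero, zero_dotProduct] at hφ1
    exact zero_ne_one hφ1
  have hφgs : IsGroundStateInSector H N M φ := ⟨hφS, hφ0, hφE⟩
  have hbφ := h φ hφ1 hφgs hbloch hc₃
  -- `Re⟨ψ, A ψ⟩ ≤ Re⟨φ, A φ⟩ ≤ b`
  have hle := hmin ψ hψG hψ
  rw [neg_mulVec, neg_mulVec, dotProduct_neg, dotProduct_neg, Complex.neg_re, Complex.neg_re,
    neg_le_neg_iff, re_star_dotProduct_modeSum_mulVec, re_star_dotProduct_modeSum_mulVec] at hle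
  exact hle.trans hbφ

/-- **Window form.** The same reduction for the crux's window functional
`Σ_{m ≠ 0, |q_m| ≤ ε} S_ψ(m)`: an upper bound valid on every Bloch sector ground state of
definite total spin is valid on every sector ground state. [folklore] -/
theorem forall_ground_windowSum_le_of_spinBloch (L : ℕ) [NeZero L] (g : Site 2 → ℝ) (t U : ℝ)
    (N : ℕ) (M : ℝ) (ε b : ℝ)
    (h : ∀ ψ : Fock (Orb (FermionTorus 2 L)), star ψ ⬝ᵥ ψ = 1 →
      IsGroundStateInSector (hubbardTorus 2 L t U) N M ψ →
        (∀ v : TorusSite 2 L, ∃ c : ℂ, (fockTranslate v).val *ᵥ ψ = c • ψ) →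
          (∃ s : ℂ, (spinSq : Matrix (Finset (Orb (FermionTorus 2 L))) _ ℂ) *ᵥ ψ = s • ψ) →
            (∑ m : TorusSite 2 L, if m ≠ 0 ∧ momentumNormSq L m ≤ ε ^ 2 then
                pairStructureFactor g L ψ m else 0) ≤ b)
    (ψ : Fock (Orb (FermionTorus 2 L))) (hψ : star ψ ⬝ᵥ ψ = 1)
    (hgs : IsGroundStateInSector (hubbardTorus 2 L t U) N M ψ) :
    (∑ m : TorusSite 2 L, if m ≠ 0 ∧ momentumNormSq L m ≤ ε ^ 2 then
        pairStructureFactor g L ψ m else 0) ≤ b := by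
  classical
  -- window weights `w_m = 1_{window}(m) / L²`
  set w : TorusSite 2 L → ℝ := fun m =>
    if m ≠ 0 ∧ momentumNormSq L m ≤ ε ^ 2 then ((L : ℝ) ^ 2)⁻¹ else 0 with hw
  have hsum : ∀ φ : Fock (Orb (FermionTorus 2 L)),
      (∑ m : TorusSite 2 L, if m ≠ 0 ∧ momentumNormSq L m ≤ ε ^ 2 then
          pairStructureFactor g L φ m else 0) =
        ∑ m : TorusSite 2 L, w m * (star (pairFieldAt g L m *ᵥ φ) ⬝ᵥ (pairFieldAt g L m *ᵥ φ)).re := by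
    intro φ
    refine Finset.sum_congr rfl fun m _ => ?_
    simp only [hw, pairStructureFactor_apply]
    split_ifs
    · rw [div_eq_inv_mul]
    · rw [zero_mul]
  rw [hsum]
  exact forall_ground_modeSum_le_of_spinBloch L g t U N M w b
    (fun φ hφ hφgs hbl hsp => (hsum φ) ▸ h φ hφ hφgs hbl hsp) ψ hψ hgs

end SpinBloch

/-! ### §4 The crux needs Bloch ground states of definite total spin only -/

/-- **Spin × Bloch reduction of the crux.** `WindowInfraredBound` is equivalent to the same
statement with the ground states restricted to normalised `(N_L, S^z = 0)`-sector ground states of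
`hubbardTorus 2 L 1 U` that are eigenvectors of every lattice translation `fockTranslate v` AND of
the total-spin Casimir `spinSq` — with the same `(C, ε₀, L₀)` (`→`: drop the hypotheses; `←`:
`forall_ground_windowSum_le_of_spinBloch` at `b = C ε L²`; the crux is its `pairStructureFactor`
form by `wib_iff_pairStructureFactor`). Tasaki (2020) §2.1, §2.4, §4.1. [folklore] -/
theorem windowInfraredBound_iff_spinBloch : FunctionFieldCertificate.WindowInfraredBound ↔
    ∀ U : ℝ, 0 < U → ∀ δ ∈ Set.Ioo (0:ℝ) (1 / 2), ∃ C ε₀ : ℝ, 0 ≤ C ∧ 0 < ε₀ ∧ ∃ L₀ : ℕ,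
      ∀ ε ∈ Set.Ioc (0:ℝ) ε₀, ∀ (L : ℕ) [NeZero L], L₀ ≤ L → Even L →
        ∀ ψ : Fock (Orb (FermionTorus 2 L)), star ψ ⬝ᵥ ψ = 1 →
          IsGroundStateInSector (hubbardTorus 2 L 1 U) (2 * ⌊(1 - δ) * (L : ℝ) ^ 2 / 2⌋₊) 0 ψ →
            (∀ v : TorusSite 2 L, ∃ c : ℂ, (fockTranslate v).val *ᵥ ψ = c • ψ) →
              (∃ s : ℂ, (spinSq : Matrix (Finset (Orb (FermionTorus 2 L))) _ ℂ) *ᵥ ψ = s • ψ) →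
                (∑ m : TorusSite 2 L, if m ≠ 0 ∧ momentumNormSq L m ≤ ε ^ 2 then
                    pairStructureFactor dWaveFormFactor L ψ m else 0) ≤ C * ε * (L : ℝ) ^ 2 := by
  rw [wib_iff_pairStructureFactor]
  constructor
  · intro hW U hU δ hδ
    obtain ⟨C, ε₀, hC, hε₀, L₀, hall⟩ := hW U hU δ hδ
    exact ⟨C, ε₀, hC, hε₀, L₀, fun ε hε L _ hL₀ hE ψ hψ hgs _ _ => hall ε hε L hL₀ hE ψ hψ hgs⟩
  · intro hB U hU δ hδ
    obtain ⟨C, ε₀, hC, hε₀, L₀, hall⟩ := hB U hU δ hδ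
    refine ⟨C, ε₀, hC, hε₀, L₀, fun ε hε L _ hL₀ hE ψ hψ hgs => ?_⟩
    exact forall_ground_windowSum_le_of_spinBloch L dWaveFormFactor 1 U _ 0 ε (C * ε * (L : ℝ) ^ 2)
      (fun φ hφ hφgs hbl hsp => hall ε hε L hL₀ hE φ hφ hφgs hbl hsp) ψ hψ hgs

/-- **Spin × Bloch reduction of the `KacWindowPenalty` copy of the crux** (the two route decls are
the same proposition, `wib_functionField_iff_kac`). [folklore] -/
theorem kacWindowInfraredBound_iff_spinBloch : KacWindowPenalty.WindowInfraredBound ↔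
    ∀ U : ℝ, 0 < U → ∀ δ ∈ Set.Ioo (0:ℝ) (1 / 2), ∃ C ε₀ : ℝ, 0 ≤ C ∧ 0 < ε₀ ∧ ∃ L₀ : ℕ,
      ∀ ε ∈ Set.Ioc (0:ℝ) ε₀, ∀ (L : ℕ) [NeZero L], L₀ ≤ L → Even L →
        ∀ ψ : Fock (Orb (FermionTorus 2 L)), star ψ ⬝ᵥ ψ = 1 →
          IsGroundStateInSector (hubbardTorus 2 L 1 U) (2 * ⌊(1 - δ) * (L : ℝ) ^ 2 / 2⌋₊) 0 ψ →
            (∀ v : TorusSite 2 L, ∃ c : ℂ, (fockTranslate v).val *ᵥ ψ = c • ψ) →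
              (∃ s : ℂ, (spinSq : Matrix (Finset (Orb (FermionTorus 2 L))) _ ℂ) *ᵥ ψ = s • ψ) →
                (∑ m : TorusSite 2 L, if m ≠ 0 ∧ momentumNormSq L m ≤ ε ^ 2 then
                    pairStructureFactor dWaveFormFactor L ψ m else 0) ≤ C * ε * (L : ℝ) ^ 2 :=
  wib_functionField_iff_kac.symm.trans windowInfraredBound_iff_spinBloch

/-- **Sufficiency form for provers**: a window bound proved on Bloch sector ground states of
definite total spin only closes the crux. [folklore] -/
theorem windowInfraredBound_of_spinBloch
    (h : ∀ U : ℝ, 0 < U → ∀ δ ∈ Set.Ioo (0:ℝ) (1 / 2), ∃ C ε₀ : ℝ, 0 ≤ C ∧ 0 < ε₀ ∧ ∃ L₀ : ℕ,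
      ∀ ε ∈ Set.Ioc (0:ℝ) ε₀, ∀ (L : ℕ) [NeZero L], L₀ ≤ L → Even L →
        ∀ ψ : Fock (Orb (FermionTorus 2 L)), star ψ ⬝ᵥ ψ = 1 →
          IsGroundStateInSector (hubbardTorus 2 L 1 U) (2 * ⌊(1 - δ) * (L : ℝ) ^ 2 / 2⌋₊) 0 ψ →
            (∀ v : TorusSite 2 L, ∃ c : ℂ, (fockTranslate v).val *ᵥ ψ = c • ψ) →
              (∃ s : ℂ, (spinSq : Matrix (Finset (Orb (FermionTorus 2 L))) _ ℂ) *ᵥ ψ = s • ψ) →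
                (∑ m : TorusSite 2 L, if m ≠ 0 ∧ momentumNormSq L m ≤ ε ^ 2 then
                    pairStructureFactor dWaveFormFactor L ψ m else 0) ≤ C * ε * (L : ℝ) ^ 2) :
    FunctionFieldCertificate.WindowInfraredBound :=
  windowInfraredBound_iff_spinBloch.2 h

end Summit.HubbardSuperconductivity.HubbardSuperconductivity.Theorems.WindowInfraredBound
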